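import Summits.Ventures.PercRepro.S1TriangleBoundSix

/-!
# PercRepro — THE REFINED TRIANGLE BOUND `triBound8`: the bootstrap from the kernel `8` at nullity `5` with the
restriction-refined step (p8, gen 23; a feeder for S4 — the top of the `q = 7` window, the row `38`)

The bootstrapped triangle count runs `F(ν + 1) = F(ν) + tmax (F ν)` (`2m² ≤ 2m + 3F`, from the star `|U| ≥ 2m + 1` and
the double count `|U|·m ≤ 3·s₃ ≤ 3m + 3F` at the point `x` on the fewest triangles, `m := t_x`). THE RESTRICTION STEP
(S1TriangleKernelFiveLemmas, S1TriangleCountBootEight) adds: either the restriction `M ↾ U` to `U = ⋃ triangles` has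
smaller nullity (then the bound at that nullity applies), or `|U| = r(U) + ν`, and `r(U) ≥ 4` when `|U| ≥ 7` (C2),
`r(U) ≥ 5` when `|U| ≥ 11` (C3: rank-`≤ 4` sets have `≤ 10` points); with `|U| ≥ 2m + 1` this gives, for `3 ≤ m ≤ 4`,
`(ν + 1)·m ≤ 3F` and, for `m ≥ 5`, `(ν + 2)·m ≤ 3F` (`F` the bound at nullity `ν − 1`). **`stepR d F`** is the largest
`m` allowed by both constraints (with `ν = d + 1`), **`triBound8`** the recursion from the kernel `8` at nullity `5`
(S1TriangleKernelFive): `0, 1, 2, 4, 6, 8, 11, 15, 19, 24, 30, 36, 43, 51, 60, 70, 80, …` — `19` against `22` at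
`ν = 8`, which is what the cell `(38, 8)` of level `7` needs. Here the definitions, the recursion (`triBound8_succ`,
`5 ≤ ν`), the two halves of the value of `stepR` (`le_stepR_of`, `stepR_eq_of` — the step `t + 1` violates the star
constraint, or the restriction constraint in its `m ≤ 4` or, for `t ≥ 4`, its `m ≥ 5` form), the step of the values
(`triBound8_succ_eq`), monotonicity and the values `d ≤ 5`. Axioms: standard.
-/

namespace PercRepro

namespace S1

/-- The predicate of the refined step at nullity `d + 1` from the bound `F` at nullity `d`: the star constraint
`2m² ≤ 2m + 3F` and the restriction constraint (`m ≤ 2`, or `3 ≤ m ≤ 4` with `(d + 2)·m ≤ 3F`, or `5 ≤ m` with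
`(d + 3)·m ≤ 3F`). -/
abbrev StepOK (d F m : ℕ) : Prop :=
  2 * m * m ≤ 2 * m + 3 * F ∧
    (m ≤ 2 ∨ (3 ≤ m ∧ m ≤ 4 ∧ (d + 2) * m ≤ 3 * F) ∨ (5 ≤ m ∧ (d + 3) * m ≤ 3 * F))

/-- **The refined step**: the largest `m ≤ 3F + 2` with `StepOK d F m`. -/
def stepR (d F : ℕ) : ℕ := Nat.findGreatest (StepOK d F) (3 * F + 2)

/-- **The refined bootstrap**: `triBound8 ν = triBound6 ν` for `ν ≤ 4`, `triBound8 5 = 8` (the kernel at nullity `5`), and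
`triBound8 (ν + 1) = triBound8 ν + stepR ν (triBound8 ν)` from `ν = 5` on. -/
def triBound8 : ℕ → ℕ
  | 0 => 0
  | 1 => 1
  | 2 => 2
  | 3 => 4
  | 4 => 6
  | 5 => 8
  | d + 6 => triBound8 (d + 5) + stepR (d + 5) (triBound8 (d + 5))

/-- The recursion of `triBound8` from `ν = 5` on. -/
theorem triBound8_succ (d : ℕ) (hd : 5 ≤ d) :
    triBound8 (d + 1) = triBound8 d + stepR d (triBound8 d) := by
  obtain ⟨k, rfl⟩ := Nat.exists_eq_add_of_le hd
  rw [show 5 + k + 1 = k + 6 by omega, show 5 + k = k + 5 by omega]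
  rfl

/-- The search bound of `stepR` is safe: `StepOK d F m` forces `m ≤ 3F + 2`. -/
theorem le_of_stepOK {d F m : ℕ} (h : StepOK d F m) : m ≤ 3 * F + 2 := by
  obtain ⟨h1, -⟩ := h
  by_contra hlt
  push Not at hlt
  nlinarith [h1, hlt]

/-- **The lower half**: an allowed `m` is at most `stepR d F`. -/
theorem le_stepR_of {d F m : ℕ} (h : StepOK d F m) : m ≤ stepR d F :=
  Nat.le_findGreatest (le_of_stepOK h) h

/-- **The value of `stepR`**: if `StepOK d F t` with `2 ≤ t`, and the step `t + 1` violates the star constraint or the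
restriction constraint, then `stepR d F = t`. -/
theorem stepR_eq_of {d F t : ℕ} (ht : 2 ≤ t) (h1 : StepOK d F t)
    (h2 : 2 * (t + 1) + 3 * F < 2 * (t + 1) * (t + 1) ∨ 3 * F < (d + 2) * (t + 1) ∨
      (4 ≤ t ∧ 3 * F < (d + 3) * (t + 1))) : stepR d F = t := by
  unfold stepR
  rw [Nat.findGreatest_eq_iff]
  refine ⟨le_of_stepOK h1, fun _ => h1, fun n hn _ hP => ?_⟩
  obtain ⟨hPa, hPb⟩ := hP
  rcases h2 with h2 | h2 | ⟨ht4, h2⟩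
  · have hmono : 2 * (t + 1) * (t + 1) ≤ 2 * (t + 1) + 3 * F := by nlinarith [hPa, hn]
    omega
  · rcases hPb with h | ⟨-, -, h⟩ | ⟨-, h⟩
    · omega
    · have : (d + 2) * (t + 1) ≤ (d + 2) * n := Nat.mul_le_mul_left (d + 2) hn
      omega
    · have : (d + 2) * (t + 1) ≤ (d + 3) * n := by nlinarith [hn]
      omega
  · rcases hPb with h | ⟨-, h4, -⟩ | ⟨-, h⟩
    · omega
    · omega
    · have : (d + 3) * (t + 1) ≤ (d + 3) * n := Nat.mul_le_mul_left (d + 3) hn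
      omega

/-- **The step of the values**: for `5 ≤ d`, if `triBound8 d = F`, `StepOK d F t` with `2 ≤ t`, and `t + 1` violates
one of the two constraints, then `triBound8 (d + 1) = F + t`. -/
theorem triBound8_succ_eq {d F t : ℕ} (hd : 5 ≤ d) (hF : triBound8 d = F) (ht : 2 ≤ t) (h1 : StepOK d F t)
    (h2 : 2 * (t + 1) + 3 * F < 2 * (t + 1) * (t + 1) ∨ 3 * F < (d + 2) * (t + 1) ∨
      (4 ≤ t ∧ 3 * F < (d + 3) * (t + 1))) :
    triBound8 (d + 1) = F + t := by
  rw [triBound8_succ d hd, hF, stepR_eq_of ht h1 h2]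

/-- `triBound8` never decreases. -/
theorem triBound8_le_succ (d : ℕ) : triBound8 d ≤ triBound8 (d + 1) := by
  rcases Nat.lt_or_ge d 5 with h | h
  · interval_cases d <;> decide
  · rw [triBound8_succ d h]
    exact Nat.le_add_right _ _

/-- `triBound8` is monotone. -/
theorem triBound8_mono {d d' : ℕ} (h : d ≤ d') : triBound8 d ≤ triBound8 d' :=
  monotone_nat_of_le_succ triBound8_le_succ h

/-- `triBound8 d = triBound6 d` for `d ≤ 4`. -/
theorem triBound8_eq_triBound6_of_le_four {d : ℕ} (hd : d ≤ 4) : triBound8 d = triBound6 d := by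
  interval_cases d <;> rfl

/-- `triBound8 0 = 0`. -/
theorem triBound8_val_0 : triBound8 0 = 0 := rfl

/-- `triBound8 1 = 1`. -/
theorem triBound8_val_1 : triBound8 1 = 1 := rfl

/-- `triBound8 2 = 2`. -/
theorem triBound8_val_2 : triBound8 2 = 2 := rfl

/-- `triBound8 3 = 4`. -/
theorem triBound8_val_3 : triBound8 3 = 4 := rfl

/-- `triBound8 4 = 6`. -/
theorem triBound8_val_4 : triBound8 4 = 6 := rfl

/-- `triBound8 5 = 8`. -/
theorem triBound8_val_5 : triBound8 5 = 8 := rfl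

/-- `triBound8 6 = 11` (`stepR 5 8 = 3`: `m = 4` fails `7·4 ≤ 24`). -/
theorem triBound8_val_6 : triBound8 6 = 11 :=
  triBound8_succ_eq (t := 3) (by norm_num) triBound8_val_5 (by norm_num) (by decide) (by decide)

/-- `triBound8 7 = 15` (`stepR 6 11 = 4`: `m = 5` fails `9·5 ≤ 33`). -/
theorem triBound8_val_7 : triBound8 7 = 15 :=
  triBound8_succ_eq (t := 4) (by norm_num) triBound8_val_6 (by norm_num) (by decide) (by decide)

/-- `triBound8 8 = 19` (`stepR 7 15 = 4`: `m = 5` fails `10·5 ≤ 45`). -/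
theorem triBound8_val_8 : triBound8 8 = 19 :=
  triBound8_succ_eq (t := 4) (by norm_num) triBound8_val_7 (by norm_num) (by decide) (by decide)

end S1

end PercRepro
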